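import Mathlib.Analysis.Calculus.Deriv.Polynomial
import Mathlib.Analysis.Calculus.Deriv.Mul
import Mathlib.Analysis.Calculus.Deriv.Pow
import Mathlib.Analysis.Calculus.Deriv.Add
import Mathlib.LinearAlgebra.Matrix.ToLinearEquiv
import Mathlib.Algebra.Order.Antidiag.FinsuppEquiv
import Mathlib.Data.Finsupp.Weight
import Literature.Barriers.Schanuel.EFunctionValuesAtAlgebraicPointsArith
import HarnessLib

/-!
# Barrier (Schanuel) `EFunctionValuesAtAlgebraicPoints`: Siegel's product trick — scalar equations from systems, and the monomial systems — proofs only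

`Literature/Barriers/Schanuel/EFunctionValuesAtAlgebraicPointsProducts.lean` — sibling file of
`EFunctionValuesAtAlgebraicPoints.lean` in the programme to discharge `siegelShidlovskii_algIndep`
(Siegel–Shidlovskii; Rivoal Thm. 5.10), on the side of the REDUCTION of Thm. 5.10 to the rank
theorem 5.20 (`shidlovskii_rankBound`, `SiegelShidlovskiiRank.lean`) by "l'astuce de Siegel"
(Rivoal pp. 240–241; Baker Ch. 11 p. 114). Base: `…Series.lean` (`ExpBound`, `eSeries` calculus)
and `…Arith.lean` (`IsArithE`, `eprodSeq`). Two PROVED ingredients of that reduction: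

1. **Cyclic-vector lemma** (`exists_ode_of_system`): every member of a finite family of
   `E`-series `(Gᵢ)` solving `T(z)Gᵢ′ = ∑ⱼ Bᵢⱼ(z)Gⱼ` (`T ≠ 0`, `T, Bᵢⱼ ∈ K[z]`, `K ⊂ ℚ̄`)
   satisfies a non-trivial scalar linear differential equation with coefficients in `ℚ̄[z]` —
   condition (i) of Définition 5.2 for the products used in Siegel's trick. Mechanism
   (Rivoal p. 238, "Aparté": the matrices `A_k` with `Y⁽ᵏ⁾ = A_k Y`, `A_{k+1} = A_k′ + A_k A`,
   `TᵏA_k ∈ M(ℚ̄[z])`): `Tᵏ Gᵢ⁽ᵏ⁾ = ∑ⱼ (C_k)ᵢⱼ Gⱼ` with polynomial matrices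
   `C_{k+1} = T C_k′ + C_k B - k T′ C_k` (`sysIter`, `pow_mul_iteratedDeriv_eq_sum`), and `#ι + 1`
   row vectors in `K[z]^ι` are linearly dependent (a determinant with a zero column).
2. **Siegel's monomial systems** (`emon_system`): with `G = (1, F₁, …, Fₙ)` (`extFamily`) and
   `T Fᵢ′ = ∑ Bᵢⱼ Fⱼ`, the degree-`m` monomials `G^μ` (`emon`, indexed by
   `MonIdx n m = {μ : Fin (n+1) →₀ ℕ, |μ| = m}`, of cardinality `(n+m choose m)`,
   `card_monIdx`) are again `E`-series satisfying the arithmetic conditions (`isArithE_emon`),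
   with coefficients in any subfield containing those of the `Fᵢ` (`emon_mem`), values
   `G^μ(z) = ∏ Fᵢ(z)^{μᵢ₊₁}` (`eSeries_emon`), and solve the linear system
   `T (G^μ)′ = ∑_ν (∑_{i,j : ν = μ - eᵢ + eⱼ} μᵢ Bᵢⱼ⁺) G^ν` (`monMatrix`, `emon_system`) with the
   SAME `T` — "une relation polynomiale … n'est rien d'autre qu'une relation linéaire … entre les
   diverses `E`-fonctions que l'on obtient en faisant des produits des `Fⱼ(z)`" (p. 240).

## References

* [Rivoal2024] T. Rivoal, *Les E-fonctions et G-fonctions de Siegel*, Journées X-UPS 2019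
  (2024), doi:10.5802/xups.2019-03: §5.3 pp. 237–241 (p. 238 "Aparté", p. 240).
-/

noncomputable section

open Complex Polynomial Finset
open scoped Nat

namespace Literature.Barriers.Schanuel

-- `ℚ`-algebra diamond on subfields of `ℂ`: see `EFunctionValuesAtAlgebraicPointsArith.lean`.
attribute [-instance] DivisionRing.toRatAlgebra

/-! ### 1. The cyclic-vector lemma: a system yields scalar differential equations -/

section Cyclic

variable {K : IntermediateField ℚ ℂ} {ι : Type} [Fintype ι] [DecidableEq ι]

/-- The polynomial matrices `C_k` with `Tᵏ Y⁽ᵏ⁾ = C_k Y` for a solution `Y` of `T Y′ = B Y`: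
`C₀ = 1`, `C_{k+1} = T C_k′ + C_k B - k T′ C_k`. [cite: Rivoal2024, §5.3 p. 238] -/
def sysIter (T : Polynomial K) (B : Matrix ι ι (Polynomial K)) : ℕ → Matrix ι ι (Polynomial K)
  | 0 => 1
  | k + 1 => T • (sysIter T B k).map derivative + sysIter T B k * B -
      ((k : Polynomial K) * derivative T) • sysIter T B k

/-- `k x^{k-1} x = k xᵏ` (also for `k = 0`). [folklore] -/
private theorem natCast_mul_pow_pred_mul (k : ℕ) (x : ℂ) : (k : ℂ) * x ^ (k - 1) * x = k * x ^ k := by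
  cases k with
  | zero => simp
  | succ k => rw [Nat.add_sub_cancel, pow_succ]; ring

/-- **`Tᵏ Gᵢ⁽ᵏ⁾ = ∑ⱼ (C_k)ᵢⱼ Gⱼ`** for `E`-series `Gᵢ = eSeries (f i)` with `T Gᵢ′ = ∑ⱼ Bᵢⱼ Gⱼ`.
[cite: Rivoal2024, §5.3 p. 238] -/
theorem pow_mul_iteratedDeriv_eq_sum (f : ι → ℕ → ℂ) (hf : ∀ i, ExpBound (f i))
    (T : Polynomial K) (B : Matrix ι ι (Polynomial K))
    (hsys : ∀ i z, aeval z T * deriv (eSeries (f i)) z = ∑ j, aeval z (B i j) * eSeries (f j) z)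
    (k : ℕ) (i : ι) (z : ℂ) :
    aeval z T ^ k * iteratedDeriv k (eSeries (f i)) z =
      ∑ j, aeval z (sysIter T B k i j) * eSeries (f j) z := by
  induction k generalizing i z with
  | zero =>
    simp only [pow_zero, one_mul, iteratedDeriv_zero, sysIter]
    rw [Finset.sum_eq_single i]
    · simp
    · intro j _ hji
      simp [Matrix.one_apply_ne' hji]
    · exact fun h => (h (mem_univ i)).elim
  | succ k ih =>
    -- notation
    set t : ℂ → ℂ := fun z => aeval z T with ht
    have htd : ∀ z, HasDerivAt t (aeval z (derivative T)) z := fun z => Polynomial.hasDerivAt_aeval T z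
    have hG : ∀ j z, HasDerivAt (eSeries (f j)) (eSeries (fun n => f j (n + 1)) z) z :=
      fun j z => (hf j).hasDerivAt_eSeries z
    have hderivG : ∀ j, deriv (eSeries (f j)) = eSeries (fun n => f j (n + 1)) :=
      fun j => deriv_eSeries (hf j)
    -- `g_k = G_i^{(k)}` and its derivative
    have hgk : ∀ z, HasDerivAt (iteratedDeriv k (eSeries (f i)))
        (iteratedDeriv (k + 1) (eSeries (f i)) z) z := by
      intro z
      rw [iteratedDeriv_eSeries (hf i) k, iteratedDeriv_eSeries (hf i) (k + 1)]
      have := ((hf i).shift_iterate k).hasDerivAt_eSeries z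
      convert this using 2
      funext n
      rw [Nat.add_right_comm, Nat.add_assoc]
    -- the two sides of the induction hypothesis, as functions, and their derivatives
    have hfun : (fun z => t z ^ k * iteratedDeriv k (eSeries (f i)) z) =
        fun z => ∑ j, aeval z (sysIter T B k i j) * eSeries (f j) z := funext fun z => ih i z
    have hL : HasDerivAt (fun z => t z ^ k * iteratedDeriv k (eSeries (f i)) z)
        ((k : ℂ) * t z ^ (k - 1) * aeval z (derivative T) * iteratedDeriv k (eSeries (f i)) z +
          t z ^ k * iteratedDeriv (k + 1) (eSeries (f i)) z) z :=
      ((htd z).pow k).mul (hgk z)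
    have hR : HasDerivAt (fun z => ∑ j, aeval z (sysIter T B k i j) * eSeries (f j) z)
        (∑ j, (aeval z (derivative (sysIter T B k i j)) * eSeries (f j) z +
          aeval z (sysIter T B k i j) * eSeries (fun n => f j (n + 1)) z)) z :=
      HasDerivAt.fun_sum fun j _ => (Polynomial.hasDerivAt_aeval _ z).mul (hG j z)
    rw [← hfun] at hR
    have hDE := hL.unique hR
    -- the system, inside the sum
    have hS : ∑ j, t z * (aeval z (sysIter T B k i j) * eSeries (fun n => f j (n + 1)) z) =
        ∑ j, aeval z (sysIter T B k i j) * ∑ l, aeval z (B j l) * eSeries (f l) z := by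
      refine sum_congr rfl fun j _ => ?_
      rw [← hsys j z, hderivG j]
      ring
    -- assemble
    have key : t z ^ (k + 1) * iteratedDeriv (k + 1) (eSeries (f i)) z =
        ∑ j, t z * (aeval z (derivative (sysIter T B k i j)) * eSeries (f j) z) +
        ∑ j, aeval z (sysIter T B k i j) * ∑ l, aeval z (B j l) * eSeries (f l) z -
        (k : ℂ) * aeval z (derivative T) * ∑ j, aeval z (sysIter T B k i j) * eSeries (f j) z := by
      rw [← hS, ← ih i z]
      have hpow : (k : ℂ) * t z ^ (k - 1) * t z = k * t z ^ k := natCast_mul_pow_pred_mul k (t z)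
      have := congrArg (fun w => t z * w) hDE
      simp only [mul_add, sum_add_distrib, mul_sum] at this
      rw [pow_succ]
      linear_combination this - (aeval z (derivative T) * iteratedDeriv k (eSeries (f i)) z) * hpow
    rw [key]
    -- expand the right-hand side
    simp only [sysIter, Matrix.sub_apply, Matrix.add_apply, Matrix.smul_apply, Matrix.map_apply,
      Matrix.mul_apply, smul_eq_mul, map_sub, map_add, map_mul, map_sum, map_natCast, sub_mul,
      add_mul, sum_sub_distrib, sum_add_distrib, mul_sum, sum_mul]
    congr 1
    · congr 1
      · exact sum_congr rfl fun j _ => by ring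
      · rw [sum_comm]
        exact sum_congr rfl fun j _ => sum_congr rfl fun l _ => by ring
    · exact sum_congr rfl fun j _ => by ring

/-- **Cyclic-vector lemma**: each member of a finite family of exponentially bounded `E`-series
solving `T Gᵢ′ = ∑ⱼ Bᵢⱼ Gⱼ` with `T ≠ 0`, `T, Bᵢⱼ ∈ K[z]`, `K` a subfield of `ℚ̄`, satisfies a
non-trivial linear differential equation of order `≤ #ι` with coefficients in `ℚ̄[z]`
(condition (i) of Définition 5.2). [cite: Rivoal2024, §5.3 p. 238] -/
theorem exists_ode_of_system (hK : ∀ x ∈ K, IsAlgebraic ℚ x) (f : ι → ℕ → ℂ)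
    (hf : ∀ i, ExpBound (f i)) (T : Polynomial K) (hT : T ≠ 0) (B : Matrix ι ι (Polynomial K))
    (hsys : ∀ i z, aeval z T * deriv (eSeries (f i)) z = ∑ j, aeval z (B i j) * eSeries (f j) z)
    (i : ι) :
    ∃ (m : ℕ) (P : Fin (m + 1) → Polynomial ℂ), P ≠ 0 ∧ (∀ j k, IsAlgebraic ℚ ((P j).coeff k)) ∧
      ∀ z : ℂ, ∑ j : Fin (m + 1), (P j).eval z * iteratedDeriv j (eSeries (f i)) z = 0 := by
  classical
  set N := Fintype.card ι with hN
  set e : ι ≃ Fin N := Fintype.equivFin ι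
  -- the `(N+1) × (N+1)` matrix of the row vectors `(C_k)ᵢ`, padded with a zero column
  set M : Matrix (Fin (N + 1)) (Fin (N + 1)) (Polynomial K) := Matrix.of fun k c =>
    if h : (c : ℕ) < N then sysIter T B k i (e.symm ⟨c, h⟩) else 0 with hM
  have hdet : M.det = 0 := by
    refine Matrix.det_eq_zero_of_column_eq_zero (Fin.last N) fun k => ?_
    simp [hM]
  obtain ⟨v, hv0, hvM⟩ := Matrix.exists_vecMul_eq_zero_iff.mpr hdet
  have hrel : ∀ j : ι, ∑ k : Fin (N + 1), v k * sysIter T B k i j = 0 := by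
    intro j
    have := congr_fun hvM (Fin.castSucc (e j))
    simp only [Matrix.vecMul, dotProduct, hM, Matrix.of_apply, Fin.val_castSucc, Fin.is_lt,
      dif_pos, Fin.eta, Equiv.symm_apply_apply, Pi.zero_apply] at this
    exact this
  -- the differential equation
  refine ⟨N, fun k => (v k * T ^ (k : ℕ)).map (algebraMap K ℂ), ?_, ?_, ?_⟩
  · obtain ⟨k, hk⟩ : ∃ k, v k ≠ 0 := by
      by_contra hcon
      push Not at hcon
      exact hv0 (funext hcon)
    intro h0
    have h1 := congr_fun h0 k
    simp only [Pi.zero_apply] at h1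
    rw [Polynomial.map_eq_zero_iff (algebraMap K ℂ).injective] at h1
    exact (mul_ne_zero hk (pow_ne_zero _ hT)) h1
  · intro j k
    rw [coeff_map]
    exact hK _ (SetLike.coe_mem _)
  · intro z
    have hid := pow_mul_iteratedDeriv_eq_sum f hf T B hsys
    calc ∑ j : Fin (N + 1), ((v j * T ^ (j : ℕ)).map (algebraMap K ℂ)).eval z *
          iteratedDeriv j (eSeries (f i)) z
        = ∑ j : Fin (N + 1), aeval z (v j) * ∑ l, aeval z (sysIter T B j i l) * eSeries (f l) z := by
          refine sum_congr rfl fun j _ => ?_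
          rw [eval_map_algebraMap, map_mul, map_pow, mul_assoc, hid]
      _ = ∑ l, aeval z (∑ j : Fin (N + 1), v j * sysIter T B j i l) * eSeries (f l) z := by
          simp only [map_sum, map_mul, mul_sum, sum_mul]
          rw [sum_comm]
          exact sum_congr rfl fun l _ => sum_congr rfl fun j _ => by ring
      _ = 0 := by simp [hrel]

end Cyclic

/-! ### 2. The extended family `G = (1, F₁, …, Fₙ)` and its system -/

section Ext

variable {K : IntermediateField ℚ ℂ} {n : ℕ} {a : Fin n → ℕ → ℂ}

/-- `G = (1, F₁, …, Fₙ)` at the level of coefficient sequences (`1 = (1, 0, 0, …)`): the trick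
"l'on peut choisir la `E`-fonction `F₁(z) = 1`" which makes degree-`m` monomials in `G` the
monomials of degree `≤ m` in `F`. [cite: Rivoal2024, §5.3 p. 241] -/
def extFamily (a : Fin n → ℕ → ℂ) : Fin (n + 1) → ℕ → ℂ :=
  Fin.cons (Pi.single 0 1) a

/-- `G₀ = 1`. [folklore] -/
@[simp] theorem extFamily_zero (a : Fin n → ℕ → ℂ) : extFamily a 0 = Pi.single 0 1 :=
  Fin.cons_zero _ _

/-- `G_{i+1} = Fᵢ`. [folklore] -/
@[simp] theorem extFamily_succ (a : Fin n → ℕ → ℂ) (i : Fin n) : extFamily a i.succ = a i :=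
  Fin.cons_succ _ _ _

/-- The members of `G` satisfy the arithmetic conditions. [folklore] -/
theorem isArithE_extFamily (ha : ∀ i, IsArithE (a i)) (i : Fin (n + 1)) : IsArithE (extFamily a i) := by
  refine Fin.cases ?_ (fun i => ?_) i
  · simpa using isArithE_single isAlgebraic_one
  · simpa using ha i

/-- The members of `G` are geometrically bounded. [folklore] -/
theorem expBound_extFamily (ha : ∀ i, ExpBound (a i)) (i : Fin (n + 1)) : ExpBound (extFamily a i) := by
  refine Fin.cases ?_ (fun i => ?_) i
  · simpa using (isArithE_single isAlgebraic_one).expBound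
  · simpa using ha i

/-- The coefficients of `G` lie in any subfield containing those of `F`. [folklore] -/
theorem extFamily_mem (K : IntermediateField ℚ ℂ) (haK : ∀ i k, a i k ∈ K) (i : Fin (n + 1)) (k : ℕ) :
    extFamily a i k ∈ K := by
  refine Fin.cases ?_ (fun i => ?_) i
  · rw [extFamily_zero]
    rcases eq_or_ne k 0 with rfl | hk
    · simp
    · simp [Pi.single_eq_of_ne hk]
  · simpa using haK i k

/-- `G₀(z) = 1`. [folklore] -/
theorem eSeries_extFamily_zero (a : Fin n → ℕ → ℂ) (z : ℂ) : eSeries (extFamily a 0) z = 1 := by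
  rw [extFamily_zero, eSeries_single]

/-- The block matrix `B⁺ = (0 0; 0 B)` of the system satisfied by `G = (1, F)`. [folklore] -/
def extMatrix (B : Matrix (Fin n) (Fin n) (Polynomial K)) :
    Matrix (Fin (n + 1)) (Fin (n + 1)) (Polynomial K) :=
  Fin.cons 0 fun i => Fin.cons 0 (B i)

/-- First row of `B⁺` vanishes. [folklore] -/
@[simp] theorem extMatrix_zero (B : Matrix (Fin n) (Fin n) (Polynomial K)) (j : Fin (n + 1)) :
    extMatrix B 0 j = 0 := by
  simp [extMatrix]

/-- First column of `B⁺` vanishes. [folklore] -/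
@[simp] theorem extMatrix_succ_zero (B : Matrix (Fin n) (Fin n) (Polynomial K)) (i : Fin n) :
    extMatrix B i.succ 0 = 0 := by
  simp [extMatrix]

/-- The `B` block of `B⁺`. [folklore] -/
@[simp] theorem extMatrix_succ_succ (B : Matrix (Fin n) (Fin n) (Polynomial K)) (i j : Fin n) :
    extMatrix B i.succ j.succ = B i j := by
  simp [extMatrix]

/-- **The system for `G = (1, F)`**: `T G₀′ = 0`, `T G_{i+1}′ = ∑ⱼ Bᵢⱼ G_{j+1}`. [folklore] -/
theorem extFamily_system (T : Polynomial K) (B : Matrix (Fin n) (Fin n) (Polynomial K))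
    (hsys : ∀ i z, aeval z T * deriv (eSeries (a i)) z = ∑ j, aeval z (B i j) * eSeries (a j) z)
    (i : Fin (n + 1)) (z : ℂ) :
    aeval z T * deriv (eSeries (extFamily a i)) z =
      ∑ j, aeval z (extMatrix B i j) * eSeries (extFamily a j) z := by
  refine Fin.cases ?_ (fun i => ?_) i
  · have h1 : eSeries (extFamily a 0) = fun _ => (1 : ℂ) := by rw [extFamily_zero, eSeries_single]
    rw [h1]
    simp
  · rw [Fin.sum_univ_succ, extFamily_succ, hsys i z]
    simp

end Ext

/-! ### 3. Siegel's monomial systems -/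

section Monomials

variable {K : IntermediateField ℚ ℂ} {n m : ℕ} {a : Fin n → ℕ → ℂ}

/-- The index set of degree-`m` monomials in `n + 1` letters: exponent vectors
`μ : Fin (n+1) →₀ ℕ` with `|μ| = m` (Mathlib's `finsuppAntidiag`). [folklore] -/
abbrev MonIdx (n m : ℕ) : Type :=
  ↥((Finset.univ : Finset (Fin (n + 1))).finsuppAntidiag m)

/-- Membership in the index set is `|μ| = m`. [folklore] -/
theorem mem_monIdx_iff {μ : Fin (n + 1) →₀ ℕ} :
    μ ∈ (Finset.univ : Finset (Fin (n + 1))).finsuppAntidiag m ↔ μ.degree = m := by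
  rw [Finset.mem_finsuppAntidiag, Finsupp.degree_eq_sum]
  simp

/-- `|μ| = m` on the index set. [folklore] -/
theorem MonIdx.degree_eq (μ : MonIdx n m) : μ.1.degree = m :=
  mem_monIdx_iff.mp μ.2

/-- **`#MonIdx n m = (n + m choose m)`** (stars and bars, Mathlib). [folklore] -/
theorem card_monIdx (n m : ℕ) : Fintype.card (MonIdx n m) = (n + m).choose m := by
  rw [Fintype.card_coe, Finset.card_finsuppAntidiag_nat_eq_choose, Finset.card_univ,
    Fintype.card_fin]
  congr 1
  omega

/-- The shifted exponent `μ - eᵢ + eⱼ` (same degree when `μᵢ ≠ 0`). [folklore] -/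
def MonIdx.shift (μ : MonIdx n m) (i j : Fin (n + 1)) (h : μ.1 i ≠ 0) : MonIdx n m :=
  ⟨μ.1 - Finsupp.single i 1 + Finsupp.single j 1, by
    rw [mem_monIdx_iff, map_add, Finsupp.degree_single]
    have hle : Finsupp.single i 1 ≤ μ.1 := Finsupp.single_le_iff.mpr (Nat.one_le_iff_ne_zero.mpr h)
    have h1 := congrArg (fun ν => Finsupp.degree ν) (tsub_add_cancel_of_le hle)
    simp only [map_add, Finsupp.degree_single, μ.degree_eq] at h1
    omega⟩

/-- Underlying exponent of the shift. [folklore] -/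
@[simp] theorem MonIdx.coe_shift (μ : MonIdx n m) (i j : Fin (n + 1)) (h : μ.1 i ≠ 0) :
    (μ.shift i j h).1 = μ.1 - Finsupp.single i 1 + Finsupp.single j 1 := rfl

/-- The list of factors of the monomial `G^μ`. [folklore] -/
def emonList (a : Fin n → ℕ → ℂ) (μ : Fin (n + 1) →₀ ℕ) : List (ℕ → ℂ) :=
  (List.ofFn fun i : Fin (n + 1) => List.replicate (μ i) (extFamily a i)).flatten

/-- Members of the factor list are members of `G`. [folklore] -/
theorem exists_eq_of_mem_emonList {μ : Fin (n + 1) →₀ ℕ} {b : ℕ → ℂ} (hb : b ∈ emonList a μ) :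
    ∃ i, b = extFamily a i := by
  rw [emonList, List.mem_flatten] at hb
  obtain ⟨l, hl, hbl⟩ := hb
  rw [List.mem_ofFn] at hl
  obtain ⟨i, rfl⟩ := hl
  exact ⟨i, List.eq_of_mem_replicate hbl⟩

/-- **The coefficient sequence of the monomial `G^μ = ∏ Gᵢ^{μᵢ}`** (iterated binomial
convolution). [cite: Rivoal2024, §5.3 p. 240] -/
def emon (a : Fin n → ℕ → ℂ) (μ : Fin (n + 1) →₀ ℕ) : ℕ → ℂ :=
  eprodSeq (emonList a μ)

/-- Monomials satisfy the arithmetic conditions of Définition 5.2. [cite: Rivoal2024, §5.3 p. 240] -/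
theorem isArithE_emon (ha : ∀ i, IsArithE (a i)) (μ : Fin (n + 1) →₀ ℕ) : IsArithE (emon a μ) :=
  isArithE_eprodSeq _ fun b hb => by
    obtain ⟨i, rfl⟩ := exists_eq_of_mem_emonList hb
    exact isArithE_extFamily ha i

/-- Monomials are geometrically bounded. [folklore] -/
theorem expBound_emon (ha : ∀ i, ExpBound (a i)) (μ : Fin (n + 1) →₀ ℕ) : ExpBound (emon a μ) :=
  expBound_eprodSeq _ fun b hb => by
    obtain ⟨i, rfl⟩ := exists_eq_of_mem_emonList hb
    exact expBound_extFamily ha i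

/-- The coefficients of the monomials lie in any subfield containing those of `F`. [folklore] -/
theorem emon_mem (K : IntermediateField ℚ ℂ) (haK : ∀ i k, a i k ∈ K) (μ : Fin (n + 1) →₀ ℕ)
    (k : ℕ) : emon a μ k ∈ K :=
  eprodSeq_mem K _ (fun b hb => by
    obtain ⟨i, rfl⟩ := exists_eq_of_mem_emonList hb
    exact extFamily_mem K haK i) k

/-- **Values of the monomials**: `eSeries (emon a μ) z = ∏ᵢ Gᵢ(z)^{μᵢ}`. [folklore] -/
theorem eSeries_emon (ha : ∀ i, ExpBound (a i)) (μ : Fin (n + 1) →₀ ℕ) (z : ℂ) :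
    eSeries (emon a μ) z = ∏ i : Fin (n + 1), eSeries (extFamily a i) z ^ μ i := by
  rw [emon, eSeries_eprodSeq _ (fun b hb => by
    obtain ⟨i, rfl⟩ := exists_eq_of_mem_emonList hb
    exact expBound_extFamily ha i) z, emonList, List.map_flatten, List.prod_flatten,
    List.map_ofFn, List.map_ofFn, List.prod_ofFn]
  refine Finset.prod_congr rfl fun i _ => ?_
  simp [List.map_replicate, List.prod_replicate]

/-- Values of the monomials in terms of `F`: `∏ᵢ Fᵢ(z)^{μᵢ₊₁}` (the letter `G₀ = 1` drops out).
[folklore] -/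
theorem eSeries_emon_eq_prod (ha : ∀ i, ExpBound (a i)) (μ : Fin (n + 1) →₀ ℕ) (z : ℂ) :
    eSeries (emon a μ) z = ∏ i : Fin n, eSeries (a i) z ^ μ i.succ := by
  rw [eSeries_emon ha, Fin.prod_univ_succ, eSeries_extFamily_zero, one_pow, one_mul]
  simp

/-- **Siegel's monomial matrix**: the coefficient of `G^ν` in `T (G^μ)′` is
`∑_{i,j : μᵢ ≠ 0, ν = μ - eᵢ + eⱼ} μᵢ B⁺ᵢⱼ`. [cite: Rivoal2024, §5.3 p. 240] -/
def monMatrix (B : Matrix (Fin (n + 1)) (Fin (n + 1)) (Polynomial K)) (m : ℕ) :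
    Matrix (MonIdx n m) (MonIdx n m) (Polynomial K) :=
  Matrix.of fun μ ν => ∑ i, ∑ j,
    if μ.1 i ≠ 0 ∧ ν.1 = μ.1 - Finsupp.single i 1 + Finsupp.single j 1
    then ((μ.1 i : ℕ) : Polynomial K) * B i j else 0

/-- The product identity behind the monomial system:
`∏ₗ xₗ^{(μ - eᵢ + eⱼ)ₗ} = xⱼ · xᵢ^{μᵢ - 1} · ∏_{l ≠ i} xₗ^{μₗ}`. [folklore] -/
theorem prod_pow_shift (x : Fin (n + 1) → ℂ) (μ : Fin (n + 1) →₀ ℕ) (i j : Fin (n + 1)) :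
    ∏ l, x l ^ ((μ - Finsupp.single i 1 + Finsupp.single j 1 : Fin (n + 1) →₀ ℕ) l) =
      x j * (x i ^ (μ i - 1) * ∏ l ∈ univ.erase i, x l ^ μ l) := by
  classical
  have h1 : ∏ l, x l ^ ((μ - Finsupp.single i 1 + Finsupp.single j 1 : Fin (n + 1) →₀ ℕ) l) =
      (∏ l, x l ^ ((μ - Finsupp.single i 1 : Fin (n + 1) →₀ ℕ) l)) *
        ∏ l, x l ^ ((Finsupp.single j 1 : Fin (n + 1) →₀ ℕ) l) := by
    rw [← prod_mul_distrib]
    refine prod_congr rfl fun l _ => ?_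
    rw [Finsupp.add_apply, pow_add]
  have h2 : ∏ l, x l ^ ((Finsupp.single j 1 : Fin (n + 1) →₀ ℕ) l) = x j := by
    rw [Finset.prod_eq_single j]
    · simp
    · intro l _ hl
      rw [Finsupp.single_apply, if_neg (Ne.symm hl), pow_zero]
    · exact fun h => (h (mem_univ j)).elim
  have h3 : ∏ l, x l ^ ((μ - Finsupp.single i 1 : Fin (n + 1) →₀ ℕ) l) =
      x i ^ (μ i - 1) * ∏ l ∈ univ.erase i, x l ^ μ l := by
    rw [← Finset.mul_prod_erase univ _ (mem_univ i)]
    congr 1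
    · simp
    · refine prod_congr rfl fun l hl => ?_
      have hli : l ≠ i := (mem_erase.mp hl).1
      rw [Finsupp.tsub_apply, Finsupp.single_apply, if_neg (Ne.symm hli), Nat.sub_zero]
  rw [h1, h2, h3]
  ring

/-- **Siegel's monomial system**: if `T Fᵢ′ = ∑ⱼ Bᵢⱼ Fⱼ` then the degree-`m` monomials
`G^μ` in `G = (1, F)` solve `T (G^μ)′ = ∑_ν (monMatrix B⁺)_{μν} G^ν` — with the same `T`.
[cite: Rivoal2024, §5.3 p. 240] -/
theorem emon_system (ha : ∀ i, ExpBound (a i)) (T : Polynomial K)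
    (B : Matrix (Fin n) (Fin n) (Polynomial K))
    (hsys : ∀ i z, aeval z T * deriv (eSeries (a i)) z = ∑ j, aeval z (B i j) * eSeries (a j) z)
    (m : ℕ) (μ : MonIdx n m) (z : ℂ) :
    aeval z T * deriv (eSeries (emon a μ.1)) z =
      ∑ ν : MonIdx n m, aeval z (monMatrix (extMatrix B) m μ ν) * eSeries (emon a ν.1) z := by
  classical
  -- notation
  set G : Fin (n + 1) → ℂ → ℂ := fun i => eSeries (extFamily a i) with hGdef
  have hGb : ∀ i, ExpBound (extFamily a i) := expBound_extFamily ha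
  set x : Fin (n + 1) → ℂ := fun i => G i z with hxdef
  set x' : Fin (n + 1) → ℂ := fun i => eSeries (fun k => extFamily a i (k + 1)) z with hx'def
  have hG' : ∀ i, HasDerivAt (G i) (x' i) z := fun i => (hGb i).hasDerivAt_eSeries z
  -- the system for `G` at `z`
  have hsysG : ∀ i, aeval z T * x' i = ∑ l, aeval z (extMatrix B i l) * x l := by
    intro i
    have := extFamily_system T B hsys i z
    rwa [(hG' i).deriv] at this
  -- monomials as product functions
  have hemon : ∀ ν : Fin (n + 1) →₀ ℕ, eSeries (emon a ν) = fun w => ∏ i, G i w ^ ν i :=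
    fun ν => funext fun w => eSeries_emon ha ν w
  have hE : ∀ ν : Fin (n + 1) →₀ ℕ, eSeries (emon a ν) z = ∏ i, x i ^ ν i := fun ν => eSeries_emon ha ν z
  -- the derivative of the product
  have hprod : HasDerivAt (fun w => ∏ i, G i w ^ μ.1 i)
      (∑ i, (∏ l ∈ univ.erase i, G l z ^ μ.1 l) • ((μ.1 i : ℂ) * G i z ^ (μ.1 i - 1) * x' i)) z :=
    HasDerivAt.fun_finsetProd (u := univ) (f := fun i w => G i w ^ μ.1 i) fun i _ => (hG' i).pow (μ.1 i)
  -- the common value of both sides, term by term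
  set g : Fin (n + 1) → Fin (n + 1) → ℂ := fun i l =>
    if μ.1 i ≠ 0 then (μ.1 i : ℂ) * aeval z (extMatrix B i l) *
      (x l * (x i ^ (μ.1 i - 1) * ∏ l' ∈ univ.erase i, x l' ^ μ.1 l')) else 0 with hgdef
  -- left-hand side
  have hLHS : aeval z T * deriv (eSeries (emon a μ.1)) z = ∑ i, ∑ l, g i l := by
    rw [hemon μ.1, hprod.deriv, mul_sum]
    refine sum_congr rfl fun i _ => ?_
    have : aeval z T * ((∏ l ∈ univ.erase i, G l z ^ μ.1 l) • ((μ.1 i : ℂ) * G i z ^ (μ.1 i - 1) * x' i)) =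
        (∏ l ∈ univ.erase i, x l ^ μ.1 l) * ((μ.1 i : ℂ) * x i ^ (μ.1 i - 1)) * (aeval z T * x' i) := by
      simp only [smul_eq_mul, hxdef]
      ring
    rw [this, hsysG i, mul_sum]
    refine sum_congr rfl fun l _ => ?_
    by_cases hμ : μ.1 i = 0
    · simp [hgdef, hμ]
    · simp only [hgdef, if_pos hμ]
      ring
  -- right-hand side
  have hRHS : ∑ ν : MonIdx n m, aeval z (monMatrix (extMatrix B) m μ ν) * eSeries (emon a ν.1) z =
      ∑ i, ∑ l, g i l := by
    have hexp : ∀ ν : MonIdx n m, aeval z (monMatrix (extMatrix B) m μ ν) * eSeries (emon a ν.1) z =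
        ∑ i, ∑ l, (if μ.1 i ≠ 0 ∧ ν.1 = μ.1 - Finsupp.single i 1 + Finsupp.single l 1
          then (μ.1 i : ℂ) * aeval z (extMatrix B i l) * ∏ i', x i' ^ ν.1 i' else 0) := by
      intro ν
      rw [monMatrix, Matrix.of_apply, map_sum, sum_mul]
      refine sum_congr rfl fun i _ => ?_
      rw [map_sum, sum_mul]
      refine sum_congr rfl fun l _ => ?_
      split_ifs with h
      · rw [map_mul, map_natCast, hE]
      · rw [map_zero, zero_mul]
    simp_rw [hexp]
    rw [sum_comm]
    refine sum_congr rfl fun i _ => ?_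
    rw [sum_comm]
    refine sum_congr rfl fun l _ => ?_
    by_cases hμ : μ.1 i = 0
    · simp [hgdef, hμ]
    · rw [Finset.sum_eq_single (μ.shift i l hμ)]
      · rw [if_pos ⟨hμ, rfl⟩, hgdef]
        simp only [if_pos hμ, MonIdx.coe_shift]
        rw [prod_pow_shift]
      · intro ν _ hne
        rw [if_neg]
        rintro ⟨-, hν⟩
        exact hne (Subtype.ext hν)
      · exact fun h => (h (mem_univ _)).elim
  rw [hLHS, hRHS]

end Monomials

end Literature.Barriers.Schanuel

end
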